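import Mathlib

/-!
# T4AdInvariant — the kernel SYMMETRY half of the NE1′ suppression lemma
(cell `pub-balaban`, T4-DAG v3 §5 row T4-O3.E-i′.K, node O3b; kernel bookkeeping, Mathlib only)

HONEST FRAMING (cell `pub-balaban`, T4-DAG PAGE 1).  The cell's T4 target is the existence AND uniqueness of the
continuum limit of Bałaban's unit-scale averaged loop expectations on a finite torus — a constructive-QFT statement
strictly beyond ultraviolet stability ([Balaban1989LargeFieldII] Thm 1 p. 355); it is NOT the Yang–Mills mass gap and
NOT the Clay problem.  This module is ELEMENTARY and asserts NOTHING about Bałaban's papers: no statement of the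
series B1–B16 is quoted, used or typed here.  It supplies, BY NAME, the two symmetry facts that the cell memo
`t4/T4-REF-O3.md` V5 (i)(ii) («conditional-mean suppression», row T4-O3.E-i′ (b)) wants to invoke: (k1) the
defining representation of SU(2) has no non-zero invariant traceless matrix, (k2) the mean of an equivariant
integrand against an invariant law is a fixed vector — hence zero.  The ANALYTIC input (that the relevant
conditional law of the fluctuation inserts IS conjugation invariant at a flat exterior) is NOT proved here; it is
only given a NAME as a hypothesis shape (§3, `FlatExteriorConjInvariant`), to be verified or refuted by row
T4-O3.E-i′ (α).  Every declaration is `[folklore]`.  Value: kernel lemma, NOT summit progress.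

## Contents

* §1 (k1) `traceless_eq_zero_of_conj_invariant`: a traceless complex 2 × 2 matrix fixed by conjugation with
  every element of `Matrix.specialUnitaryGroup (Fin 2) ℂ` is 0.  Two test elements suffice: `diag(i, −i)`
  (`phaseU`) negates the off-diagonal entries, the rotation `[[0,1],[−1,0]]` (`swapU`) exchanges the diagonal
  ones, and the trace condition finishes — Schur's lemma for the defining representation, in coordinates.  In
  particular an Ad(SU(2))-invariant element of 𝔰𝔲(2) (traceless anti-Hermitian) is 0
  (`su2_adInvariant_eq_zero`; the anti-Hermitian hypothesis is not even needed).  `NoFixedVector` is the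
  hypothesis shape "no non-zero common fixed vector" for any other group / representation (SU(N), N ≥ 3, is
  not treated here; the cell's block averaging is typed for SU(2), `BlockAveragingSU2`).
* §2 (k2) `integral_fixed_of_invariant`: for a measure `μ` on any measurable space `X`, an a.e.-measurable
  `T : X → X` with `μ.map T = μ`, a real Banach space `E`, a continuous linear `A : E →L[ℝ] E` and an
  integrand with `f (T x) = A (f x)` for all `x`: `A (∫ f ∂μ) = ∫ f ∂μ` — with NO integrability hypothesis
  (both sides vanish otherwise; `MeasureTheory.integral_map`, `ContinuousLinearMap.integral_comp_comm`,
  `integral_undef`).  Corollary `integral_eq_zero_of_noFixedVector`: a family of such symmetries with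
  `NoFixedVector` forces `∫ f ∂μ = 0`.
* §3 (k2 for SU(2)) `integral_eq_zero_of_conjEquivariant`: `X` arbitrary, maps `T h : X → X`
  (h ∈ SU(2)) preserving `μ` (`FlatExteriorConjInvariant μ T` — (k3), a HYPOTHESIS SHAPE, not a fact),
  `f : X → (Fin 2 → Fin 2 → ℂ)` pointwise traceless with `f (T h x) = h (f x) h⋆` (`ConjEquivariant`)
  ⇒ `∫ f ∂μ = 0`, also entrywise.  The configuration space `ι → SU(2)` with simultaneous conjugation
  (`conjAll`) is the instance the consumer has in mind, but nothing depends on it.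
* §4 (v2, APPEND-ONLY; row T4-O3.E-i′.K2*) SECOND MOMENTS — Schur's lemma for the conjugation
  representation of SU(2) on ℂ² ⊗ ℂ², in coordinates: a 4-index tensor `C : Fin 2 → Fin 2 → Fin 2 → Fin 2 → ℂ`
  fixed by `conj ⊗ conj` (`conj2Op U`) for every `U ∈ SU(2)` is ISOTROPIC,
  `C i j k l = α·[i = j ∧ k = l] + β·[i = l ∧ k = j]` (`isotropic_of_conj2_invariant`), and one scalar survives
  the trace constraint `Σ_i C i i k l = 0`: `β = −2α` (`isotropic_traceless_of_conj2_invariant`) — the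
  coordinate form of «an Ad-invariant symmetric bilinear form on 𝔰𝔲(2) is a multiple of the Killing form».
  Three RATIONAL test elements suffice (`ratU = diag((3+4i)/5, (3−4i)/5)`, `swapU`, the rotation
  `rotU = [[3,−4],[4,3]]/5`); no Lie theory is used.  Measure-theoretic corollary on top of §2/§3, again with
  NO integrability hypothesis: under `FlatExteriorConjInvariant μ T` and `ConjEquivariant T f` the second-moment
  tensor `∫ (x ↦ (i j k l ↦ f x i j · f x k l)) ∂μ` is `conj ⊗ conj`-invariant (`secondMoment_invariant`), hence
  isotropic (`secondMoment_isotropic`), and for pointwise traceless `f` of the one-scalar form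
  (`secondMoment_traceless`).  This is the kernel half of the step «E[B′ ⊗ B′] ∝ Killing form at a
  conjugation-invariant insert law» in the cell's first-order-size budget (journal 2026-08-18T21:40:10Z); whether
  the relevant conditional law IS conjugation invariant remains row T4-O3.E-i′ (α)'s question, exactly as for §3.

Matrix-valued Bochner integrals are taken in the function type `Fin 2 → Fin 2 → ℂ` (= what
`Matrix (Fin 2) (Fin 2) ℂ` unfolds to, `Matrix.of` being the identity equivalence), where Mathlib's product
Banach-space structure over ℝ is canonical — no matrix norm is chosen, and consumers convert with
`Matrix.of` / `Matrix.of.symm` (`conjOp`, `traceOp` are the conjugation and trace maps in that type).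
-/

noncomputable section

open MeasureTheory Complex

namespace Literature.MathematicalPhysics.QuantumFieldTheory.Balaban1983to89.T4AdInvariant

/-! ## §1 (k1) — no non-zero SU(2)-conjugation-invariant traceless matrix -/

/-- The first test element `diag(i, −i)`. [folklore] -/
def phaseU : Matrix (Fin 2) (Fin 2) ℂ := !![I, 0; 0, -I]

/-- The second test element, the rotation `[[0, 1], [−1, 0]]`. [folklore] -/
def swapU : Matrix (Fin 2) (Fin 2) ℂ := !![0, 1; -1, 0]

/-- `diag(i, −i) ∈ SU(2)`. [folklore] -/
theorem phaseU_mem : phaseU ∈ Matrix.specialUnitaryGroup (Fin 2) ℂ := by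
  rw [Matrix.mem_specialUnitaryGroup_iff]
  refine ⟨?_, ?_⟩
  · rw [Matrix.mem_unitaryGroup_iff]
    ext i j
    fin_cases i <;> fin_cases j <;> simp [phaseU, Matrix.mul_apply, Fin.sum_univ_two, Matrix.star_apply]
  · simp [phaseU, Matrix.det_fin_two]

/-- `[[0, 1], [−1, 0]] ∈ SU(2)`. [folklore] -/
theorem swapU_mem : swapU ∈ Matrix.specialUnitaryGroup (Fin 2) ℂ := by
  rw [Matrix.mem_specialUnitaryGroup_iff]
  refine ⟨?_, ?_⟩
  · rw [Matrix.mem_unitaryGroup_iff]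
    ext i j
    fin_cases i <;> fin_cases j <;> simp [swapU, Matrix.mul_apply, Fin.sum_univ_two, Matrix.star_apply]
  · simp [swapU, Matrix.det_fin_two]

/-- Conjugation by `diag(i, −i)` negates the `(0,1)` entry. [folklore] -/
theorem phaseU_conj_apply_01 (X : Matrix (Fin 2) (Fin 2) ℂ) :
    (phaseU * X * star phaseU) 0 1 = -X 0 1 := by
  simp only [Matrix.mul_apply, Fin.sum_univ_two, Matrix.star_apply]
  simp [phaseU]
  linear_combination (X 0 1) * Complex.I_mul_I

/-- Conjugation by `diag(i, −i)` negates the `(1,0)` entry. [folklore] -/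
theorem phaseU_conj_apply_10 (X : Matrix (Fin 2) (Fin 2) ℂ) :
    (phaseU * X * star phaseU) 1 0 = -X 1 0 := by
  simp only [Matrix.mul_apply, Fin.sum_univ_two, Matrix.star_apply]
  simp [phaseU]
  linear_combination (X 1 0) * Complex.I_mul_I

/-- Conjugation by the rotation moves the `(1,1)` entry to `(0,0)`. [folklore] -/
theorem swapU_conj_apply_00 (X : Matrix (Fin 2) (Fin 2) ℂ) :
    (swapU * X * star swapU) 0 0 = X 1 1 := by
  simp only [Matrix.mul_apply, Fin.sum_univ_two, Matrix.star_apply]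
  simp [swapU]

/-- (k1) A traceless complex 2 × 2 matrix invariant under conjugation by every element of SU(2) vanishes
(only the two test elements are used).  Schur's lemma for the defining representation, in coordinates.
[folklore] -/
theorem traceless_eq_zero_of_conj_invariant (X : Matrix (Fin 2) (Fin 2) ℂ) (htr : X.trace = 0)
    (h : ∀ U ∈ Matrix.specialUnitaryGroup (Fin 2) ℂ, U * X * star U = X) : X = 0 := by
  have h01 : X 0 1 = 0 := by
    have e := congrFun (congrFun (h _ phaseU_mem) 0) 1
    rw [phaseU_conj_apply_01] at e
    linear_combination (-(1:ℂ)/2) * e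
  have h10 : X 1 0 = 0 := by
    have e := congrFun (congrFun (h _ phaseU_mem) 1) 0
    rw [phaseU_conj_apply_10] at e
    linear_combination (-(1:ℂ)/2) * e
  have hdiag : X 1 1 = X 0 0 := by
    have e := congrFun (congrFun (h _ swapU_mem) 0) 0
    rwa [swapU_conj_apply_00] at e
  have htr' : X 0 0 + X 1 1 = 0 := by simpa [Matrix.trace_fin_two] using htr
  have h00 : X 0 0 = 0 := by linear_combination (htr' - hdiag) / 2
  have h11 : X 1 1 = 0 := by rw [hdiag, h00]
  ext i j
  fin_cases i <;> fin_cases j <;> simp [h00, h01, h10, h11]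

/-- (k1), subtype form: quantifying over `U : SU(2)` (for `U` unitary, `star U` is its inverse). [folklore] -/
theorem traceless_eq_zero_of_conj_invariant' (X : Matrix (Fin 2) (Fin 2) ℂ) (htr : X.trace = 0)
    (h : ∀ U : Matrix.specialUnitaryGroup (Fin 2) ℂ,
      (U : Matrix (Fin 2) (Fin 2) ℂ) * X * star (U : Matrix (Fin 2) (Fin 2) ℂ) = X) : X = 0 :=
  traceless_eq_zero_of_conj_invariant X htr fun U hU => h ⟨U, hU⟩

/-- (k1) for 𝔰𝔲(2) proper: a traceless anti-Hermitian 2 × 2 matrix (an element of 𝔰𝔲(2) in the defining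
representation) which is Ad(SU(2))-invariant is 0.  The anti-Hermitian hypothesis is carried for the record
only — it is not needed. [folklore] -/
theorem su2_adInvariant_eq_zero (X : Matrix (Fin 2) (Fin 2) ℂ) (_hah : star X = -X) (htr : X.trace = 0)
    (h : ∀ U ∈ Matrix.specialUnitaryGroup (Fin 2) ℂ, U * X * star U = X) : X = 0 :=
  traceless_eq_zero_of_conj_invariant X htr h

/-- The hypothesis shape "no non-zero common fixed vector" for a family of linear symmetries of a real
vector space, so that (k2) can be used with any compact group / representation once its instance of (k1)
is supplied. [folklore] -/
def NoFixedVector {E : Type*} [AddCommGroup E] [Module ℝ E] {H : Type*} (A : H → E →ₗ[ℝ] E) : Prop :=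
  ∀ v : E, (∀ h, A h v = v) → v = 0

/-! ## §2 (k2) — means of equivariant integrands are fixed vectors -/

section Abstract

variable {X : Type*} [MeasurableSpace X] {μ : Measure X}
variable {E : Type*} [NormedAddCommGroup E] [NormedSpace ℝ E] [CompleteSpace E]

/-- (k2) If `μ` is invariant under `T` and `f ∘ T = A ∘ f` for a continuous linear `A`, then the mean of `f`
is an `A`-fixed vector.  No integrability hypothesis: if `f` is not integrable both sides are `0`.
[folklore] -/
theorem integral_fixed_of_invariant {T : X → X} (hT : AEMeasurable T μ) (hμ : Measure.map T μ = μ)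
    (A : E →L[ℝ] E) {f : X → E} (hf : ∀ x, f (T x) = A (f x)) :
    A (∫ x, f x ∂μ) = ∫ x, f x ∂μ := by
  by_cases hint : Integrable f μ
  · have hfm : AEStronglyMeasurable f (Measure.map T μ) := by rw [hμ]; exact hint.aestronglyMeasurable
    calc A (∫ x, f x ∂μ) = ∫ x, A (f x) ∂μ := (ContinuousLinearMap.integral_comp_comm A hint).symm
      _ = ∫ x, f (T x) ∂μ := by simp_rw [hf]
      _ = ∫ x, f x ∂(Measure.map T μ) := (integral_map hT hfm).symm
      _ = ∫ x, f x ∂μ := by rw [hμ]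
  · simp [integral_undef hint]

/-- (k2), family form: if `μ` is invariant under every `T h` and `f (T h x) = A h (f x)`, and the `A h` have
no non-zero common fixed vector, then `∫ f ∂μ = 0`. [folklore] -/
theorem integral_eq_zero_of_noFixedVector {H : Type*} {T : H → X → X} (hT : ∀ h, AEMeasurable (T h) μ)
    (hμ : ∀ h, Measure.map (T h) μ = μ) (A : H → E →L[ℝ] E)
    (hA : NoFixedVector fun h => (A h : E →ₗ[ℝ] E)) {f : X → E} (hf : ∀ h x, f (T h x) = A h (f x)) :
    ∫ x, f x ∂μ = 0 :=
  hA _ fun h => integral_fixed_of_invariant (hT h) (hμ h) (A h) (hf h)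

end Abstract

/-! ## §3 — the SU(2) instance: conjugation-equivariant traceless matrix-valued integrands have mean 0

To integrate matrix-valued functions without choosing a matrix norm we write the values in the function
type `Fin 2 → Fin 2 → ℂ` (which is what `Matrix (Fin 2) (Fin 2) ℂ` unfolds to; `Matrix.of` is the identity
equivalence), where Mathlib's product Banach-space structure is canonical. -/

section SU2

variable {X : Type*} [MeasurableSpace X] {μ : Measure X}

/-- Conjugation `v ↦ U v U⋆` by a fixed matrix, as a continuous ℝ-linear map of `Fin 2 → Fin 2 → ℂ`
(finite-dimensional, so continuity is automatic). [folklore] -/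
def conjOp (U : Matrix (Fin 2) (Fin 2) ℂ) : (Fin 2 → Fin 2 → ℂ) →L[ℝ] (Fin 2 → Fin 2 → ℂ) :=
  LinearMap.toContinuousLinearMap
    { toFun := fun v i j => (U * Matrix.of v * star U) i j
      map_add' := fun v w => by
        funext i j
        rw [show Matrix.of (v + w) = Matrix.of v + Matrix.of w from rfl, Matrix.mul_add, Matrix.add_mul]
        rfl
      map_smul' := fun c v => by
        funext i j
        rw [show Matrix.of (c • v) = c • Matrix.of v from rfl, Matrix.mul_smul, Matrix.smul_mul]
        rfl }

/-- `conjOp U v i j = (U · of v · U⋆) i j`. [folklore] -/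
@[simp] theorem conjOp_apply (U : Matrix (Fin 2) (Fin 2) ℂ) (v : Fin 2 → Fin 2 → ℂ) (i j : Fin 2) :
    conjOp U v i j = (U * Matrix.of v * star U) i j := rfl

/-- The trace functional `v ↦ v 0 0 + v 1 1` as a continuous ℝ-linear map. [folklore] -/
def traceOp : (Fin 2 → Fin 2 → ℂ) →L[ℝ] ℂ :=
  LinearMap.toContinuousLinearMap
    { toFun := fun v => v 0 0 + v 1 1
      map_add' := fun v w => by simp only [Pi.add_apply]; ring
      map_smul' := fun c v => by simp only [Pi.smul_apply, RingHom.id_apply, smul_add] }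

/-- `traceOp v = v 0 0 + v 1 1`. [folklore] -/
@[simp] theorem traceOp_apply (v : Fin 2 → Fin 2 → ℂ) : traceOp v = v 0 0 + v 1 1 := rfl

/-- (k1) transported to the function type: a "traceless" `v` with `U (of v) U⋆ = of v` for all `U ∈ SU(2)`
is 0. [folklore] -/
theorem pi_traceless_eq_zero_of_conj_invariant (v : Fin 2 → Fin 2 → ℂ) (htr : v 0 0 + v 1 1 = 0)
    (h : ∀ U ∈ Matrix.specialUnitaryGroup (Fin 2) ℂ, conjOp U v = v) : v = 0 := by
  have hM : Matrix.of v = 0 := by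
    refine traceless_eq_zero_of_conj_invariant (Matrix.of v) (by simpa [Matrix.trace_fin_two] using htr)
      fun U hU => ?_
    ext i j
    have := congrFun (congrFun (h U hU) i) j
    simpa using this
  funext i j
  have := congrFun (congrFun hM i) j
  simpa using this

/-- A pointwise traceless integrand has traceless mean (no integrability needed). [folklore] -/
theorem trace_integral_eq_zero {f : X → Fin 2 → Fin 2 → ℂ} (htr : ∀ x, f x 0 0 + f x 1 1 = 0) :
    (∫ x, f x ∂μ) 0 0 + (∫ x, f x ∂μ) 1 1 = 0 := by
  by_cases hf : Integrable f μ
  · have := (ContinuousLinearMap.integral_comp_comm traceOp hf)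
    simp only [traceOp_apply, htr, integral_zero] at this
    exact this.symm
  · simp [integral_undef hf]

/-- (k3) HYPOTHESIS SHAPE, not a fact: the law `μ` on the configuration space `X` is invariant under a family
of a.e.-measurable maps `T h` (h ∈ SU(2)) — for the consumer, simultaneous conjugation of all bond variables
at a flat (pure-gauge) exterior.  Whether Bałaban's conditional insert law has this property is row
T4-O3.E-i′ (α)'s question, not settled here. [folklore] -/
def FlatExteriorConjInvariant (μ : Measure X)
    (T : Matrix.specialUnitaryGroup (Fin 2) ℂ → X → X) : Prop :=
  ∀ h, AEMeasurable (T h) μ ∧ Measure.map (T h) μ = μ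

/-- Equivariance shape of the integrand: `f (T h x) = h (f x) h⋆` (values written in `Fin 2 → Fin 2 → ℂ`).
[folklore] -/
def ConjEquivariant (T : Matrix.specialUnitaryGroup (Fin 2) ℂ → X → X)
    (f : X → Fin 2 → Fin 2 → ℂ) : Prop :=
  ∀ h x, f (T h x) = conjOp (h : Matrix (Fin 2) (Fin 2) ℂ) (f x)

/-- (k2) for SU(2): under `FlatExteriorConjInvariant μ T`, a conjugation-equivariant, pointwise traceless
matrix-valued integrand has mean zero.  (k1) supplies the absence of fixed vectors, (k2) the fixedness of the
mean; no integrability hypothesis. [folklore] -/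
theorem integral_eq_zero_of_conjEquivariant {T : Matrix.specialUnitaryGroup (Fin 2) ℂ → X → X}
    (hμ : FlatExteriorConjInvariant μ T) {f : X → Fin 2 → Fin 2 → ℂ} (hf : ConjEquivariant T f)
    (htr : ∀ x, f x 0 0 + f x 1 1 = 0) : ∫ x, f x ∂μ = 0 :=
  pi_traceless_eq_zero_of_conj_invariant _ (trace_integral_eq_zero htr) fun U hU =>
    integral_fixed_of_invariant (hμ ⟨U, hU⟩).1 (hμ ⟨U, hU⟩).2 (conjOp U) (hf ⟨U, hU⟩)

/-- The same, entrywise. [folklore] -/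
theorem integral_apply_eq_zero_of_conjEquivariant {T : Matrix.specialUnitaryGroup (Fin 2) ℂ → X → X}
    (hμ : FlatExteriorConjInvariant μ T) {f : X → Fin 2 → Fin 2 → ℂ} (hf : ConjEquivariant T f)
    (htr : ∀ x, f x 0 0 + f x 1 1 = 0) (i j : Fin 2) : (∫ x, f x ∂μ) i j = 0 := by
  rw [integral_eq_zero_of_conjEquivariant hμ hf htr]; rfl

/-- The consumer's instance of the action, for the record: simultaneous conjugation of a configuration
`x : ι → SU(2)` by `h`. [folklore] -/
def conjAll {ι : Type*} (h : Matrix.specialUnitaryGroup (Fin 2) ℂ)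
    (x : ι → Matrix.specialUnitaryGroup (Fin 2) ℂ) : ι → Matrix.specialUnitaryGroup (Fin 2) ℂ :=
  fun i => h * x i * h⁻¹

end SU2

/-! ## §4 (v2) — second moments: Schur's lemma for `conj ⊗ conj` on ℂ² ⊗ ℂ², in coordinates

The unknown is a tensor `C i j k l` (think `E[X_ij X_kl]` for a random traceless anti-Hermitian `X`).  Invariance
under `conj ⊗ conj` by the diagonal rational element `ratU` kills the ten entries whose weight is a non-trivial
power of `(3+4i)/5`; the rotation `swapU` identifies the surviving entries in pairs; the rational rotation `rotU`
supplies the one remaining relation `C 0 0 0 0 = C 0 0 1 1 + C 0 1 1 0`.  Consumers wanting entrywise integrals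
`∫ f x i j · f x k l ∂μ` instead of the evaluated tensor integral convert with `MeasureTheory.integral_apply`-type
lemmas under their own integrability hypothesis; the statements here are junk-safe without one. -/

section SecondMoment

open scoped ComplexConjugate

variable {X : Type*}

/-- The rational point `(3 + 4i)/5` of the unit circle, given by its real and imaginary parts so that every
identity about it is rational arithmetic. [folklore] -/
def u45 : ℂ := ⟨3 / 5, 4 / 5⟩

/-- `u ū = 1`. [folklore] -/
theorem u45_mul_conj : u45 * conj u45 = 1 := by
  apply Complex.ext <;> simp [u45] <;> norm_num

/-- `ū u = 1`. [folklore] -/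
theorem conj_u45_mul : conj u45 * u45 = 1 := by rw [mul_comm]; exact u45_mul_conj

/-- `u² ≠ 1` (its real part is −7/25). [folklore] -/
theorem u45_sq_ne : u45 ^ 2 ≠ 1 := by
  intro h
  have := congrArg Complex.re h
  simp [sq, u45] at this
  norm_num at this

/-- `u⁴ ≠ 1` (its real part is −527/625). [folklore] -/
theorem u45_pow_four_ne : u45 ^ 4 ≠ 1 := by
  intro h
  have := congrArg Complex.re h
  simp [pow_succ, u45] at this
  norm_num at this

/-- `ū² ≠ 1`. [folklore] -/
theorem conj_u45_sq_ne : conj u45 ^ 2 ≠ 1 := by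
  intro h
  apply u45_sq_ne
  have := congrArg conj h
  simpa using this

/-- `ū⁴ ≠ 1`. [folklore] -/
theorem conj_u45_pow_four_ne : conj u45 ^ 4 ≠ 1 := by
  intro h
  apply u45_pow_four_ne
  have := congrArg conj h
  simpa using this

/-- The diagonal rational test element `diag(u, ū)`, `u = (3+4i)/5`, of SU(2); its `conj ⊗ conj` weights
`u^{±2}, u^{±4}` are ≠ 1, unlike those of `phaseU`. [folklore] -/
def ratU : Matrix (Fin 2) (Fin 2) ℂ := !![u45, 0; 0, conj u45]

/-- The rational rotation `[[3, −4], [4, 3]]/5 ∈ SO(2) ⊂ SU(2)`. [folklore] -/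
def rotU : Matrix (Fin 2) (Fin 2) ℂ := !![3 / 5, -(4 / 5); 4 / 5, 3 / 5]

/-- `diag(u, ū) ∈ SU(2)`. [folklore] -/
theorem ratU_mem : ratU ∈ Matrix.specialUnitaryGroup (Fin 2) ℂ := by
  rw [Matrix.mem_specialUnitaryGroup_iff]
  refine ⟨?_, ?_⟩
  · rw [Matrix.mem_unitaryGroup_iff]
    ext i j
    fin_cases i <;> fin_cases j <;>
      simp [ratU, Matrix.mul_apply, Fin.sum_univ_two, Matrix.star_apply, u45_mul_conj, conj_u45_mul]
  · simp [ratU, Matrix.det_fin_two, u45_mul_conj]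

/-- `[[3, −4], [4, 3]]/5 ∈ SU(2)`. [folklore] -/
theorem rotU_mem : rotU ∈ Matrix.specialUnitaryGroup (Fin 2) ℂ := by
  rw [Matrix.mem_specialUnitaryGroup_iff]
  refine ⟨?_, ?_⟩
  · rw [Matrix.mem_unitaryGroup_iff]
    ext i j
    fin_cases i <;> fin_cases j <;>
      simp [rotU, Matrix.mul_apply, Fin.sum_univ_two, Matrix.star_apply, map_ofNat] <;> norm_num
  · simp [rotU, Matrix.det_fin_two]; norm_num

/-- `conj ⊗ conj` by a fixed matrix `U` on 4-index tensors,
`(conj2Op U C) i j k l = Σ_{a b c d} U_ia · conj(U_jb) · U_kc · conj(U_ld) · C a b c d`, as a continuous ℝ-linear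
map (finite-dimensional, so continuity is automatic). [folklore] -/
def conj2Op (U : Matrix (Fin 2) (Fin 2) ℂ) :
    (Fin 2 → Fin 2 → Fin 2 → Fin 2 → ℂ) →L[ℝ] (Fin 2 → Fin 2 → Fin 2 → Fin 2 → ℂ) :=
  LinearMap.toContinuousLinearMap
    { toFun := fun C i j k l =>
        ∑ a, ∑ b, ∑ c, ∑ d, U i a * star (U j b) * U k c * star (U l d) * C a b c d
      map_add' := fun C D => by
        funext i j k l
        simp only [Pi.add_apply, mul_add, Finset.sum_add_distrib]
      map_smul' := fun r C => by
        funext i j k l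
        simp only [Pi.smul_apply, RingHom.id_apply, Complex.real_smul, Finset.mul_sum]
        refine Finset.sum_congr rfl fun a _ => Finset.sum_congr rfl fun b _ =>
          Finset.sum_congr rfl fun c _ => Finset.sum_congr rfl fun d _ => by ring }

/-- The defining formula of `conj2Op`. [folklore] -/
@[simp] theorem conj2Op_apply (U : Matrix (Fin 2) (Fin 2) ℂ) (C : Fin 2 → Fin 2 → Fin 2 → Fin 2 → ℂ)
    (i j k l : Fin 2) : conj2Op U C i j k l =
      ∑ a, ∑ b, ∑ c, ∑ d, U i a * star (U j b) * U k c * star (U l d) * C a b c d := rfl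

/-- `conj ⊗ conj` is what `ConjEquivariant` does to the product integrand `x ↦ (f x i j · f x k l)`. [folklore] -/
theorem prod_conjEquivariant {T : Matrix.specialUnitaryGroup (Fin 2) ℂ → X → X} {f : X → Fin 2 → Fin 2 → ℂ}
    (hf : ConjEquivariant T f) (h : Matrix.specialUnitaryGroup (Fin 2) ℂ) (x : X) :
    (fun i j k l => f (T h x) i j * f (T h x) k l) =
      conj2Op (h : Matrix (Fin 2) (Fin 2) ℂ) (fun i j k l => f x i j * f x k l) := by
  funext i j k l
  rw [hf h x]
  simp only [conj2Op_apply, conjOp_apply, Matrix.mul_apply, Matrix.star_apply, Matrix.of_apply,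
    Fin.sum_univ_two]
  ring

/-- `w ≠ 0 ∧ w·z = 0 ⇒ z = 0`. [folklore] -/
theorem eq_zero_of_mul_eq_zero_left {w z : ℂ} (hw : w ≠ 0) (h : w * z = 0) : z = 0 :=
  (mul_eq_zero.mp h).resolve_left hw

/-- Invariance under `conj ⊗ conj` by `ratU` kills the ten entries of non-zero weight (weights `u², ū²` for
the eight entries with exactly one off-diagonal index pair, `u⁴, ū⁴` for `C 0 1 0 1`, `C 1 0 1 0`). [folklore] -/
theorem ratU_zeros (C : Fin 2 → Fin 2 → Fin 2 → Fin 2 → ℂ) (h : conj2Op ratU C = C) :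
    C 0 0 0 1 = 0 ∧ C 0 0 1 0 = 0 ∧ C 0 1 0 0 = 0 ∧ C 1 0 0 0 = 0 ∧ C 1 1 1 0 = 0 ∧ C 1 1 0 1 = 0 ∧
      C 1 0 1 1 = 0 ∧ C 0 1 1 1 = 0 ∧ C 0 1 0 1 = 0 ∧ C 1 0 1 0 = 0 := by
  have E := fun i j k l => congrFun (congrFun (congrFun (congrFun h i) j) k) l
  refine ⟨?_, ?_, ?_, ?_, ?_, ?_, ?_, ?_, ?_, ?_⟩
  · have e := E 0 0 0 1
    simp only [conj2Op_apply, Fin.sum_univ_two] at e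
    simp [ratU] at e
    exact eq_zero_of_mul_eq_zero_left (w := u45 ^ 2 - 1) (sub_ne_zero.mpr u45_sq_ne) (by linear_combination e - u45 ^ 2 * C 0 0 0 1 * u45_mul_conj)
  · have e := E 0 0 1 0
    simp only [conj2Op_apply, Fin.sum_univ_two] at e
    simp [ratU] at e
    exact eq_zero_of_mul_eq_zero_left (w := conj u45 ^ 2 - 1) (sub_ne_zero.mpr conj_u45_sq_ne) (by linear_combination e - conj u45 ^ 2 * C 0 0 1 0 * u45_mul_conj)
  · have e := E 0 1 0 0
    simp only [conj2Op_apply, Fin.sum_univ_two] at e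
    simp [ratU] at e
    exact eq_zero_of_mul_eq_zero_left (w := u45 ^ 2 - 1) (sub_ne_zero.mpr u45_sq_ne) (by linear_combination e - u45 ^ 2 * C 0 1 0 0 * u45_mul_conj)
  · have e := E 1 0 0 0
    simp only [conj2Op_apply, Fin.sum_univ_two] at e
    simp [ratU] at e
    exact eq_zero_of_mul_eq_zero_left (w := conj u45 ^ 2 - 1) (sub_ne_zero.mpr conj_u45_sq_ne) (by linear_combination e - conj u45 ^ 2 * C 1 0 0 0 * u45_mul_conj)
  · have e := E 1 1 1 0
    simp only [conj2Op_apply, Fin.sum_univ_two] at e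
    simp [ratU] at e
    exact eq_zero_of_mul_eq_zero_left (w := conj u45 ^ 2 - 1) (sub_ne_zero.mpr conj_u45_sq_ne) (by linear_combination e - conj u45 ^ 2 * C 1 1 1 0 * u45_mul_conj)
  · have e := E 1 1 0 1
    simp only [conj2Op_apply, Fin.sum_univ_two] at e
    simp [ratU] at e
    exact eq_zero_of_mul_eq_zero_left (w := u45 ^ 2 - 1) (sub_ne_zero.mpr u45_sq_ne) (by linear_combination e - u45 ^ 2 * C 1 1 0 1 * u45_mul_conj)
  · have e := E 1 0 1 1
    simp only [conj2Op_apply, Fin.sum_univ_two] at e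
    simp [ratU] at e
    exact eq_zero_of_mul_eq_zero_left (w := conj u45 ^ 2 - 1) (sub_ne_zero.mpr conj_u45_sq_ne) (by linear_combination e - conj u45 ^ 2 * C 1 0 1 1 * u45_mul_conj)
  · have e := E 0 1 1 1
    simp only [conj2Op_apply, Fin.sum_univ_two] at e
    simp [ratU] at e
    exact eq_zero_of_mul_eq_zero_left (w := u45 ^ 2 - 1) (sub_ne_zero.mpr u45_sq_ne) (by linear_combination e - u45 ^ 2 * C 0 1 1 1 * u45_mul_conj)
  · have e := E 0 1 0 1
    simp only [conj2Op_apply, Fin.sum_univ_two] at e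
    simp [ratU] at e
    exact eq_zero_of_mul_eq_zero_left (w := u45 ^ 4 - 1) (sub_ne_zero.mpr u45_pow_four_ne) (by linear_combination e)
  · have e := E 1 0 1 0
    simp only [conj2Op_apply, Fin.sum_univ_two] at e
    simp [ratU] at e
    exact eq_zero_of_mul_eq_zero_left (w := conj u45 ^ 4 - 1) (sub_ne_zero.mpr conj_u45_pow_four_ne) (by linear_combination e)

/-- Invariance under `conj ⊗ conj` by `swapU` identifies the surviving entries in pairs. [folklore] -/
theorem swapU_pairs (C : Fin 2 → Fin 2 → Fin 2 → Fin 2 → ℂ) (h : conj2Op swapU C = C) :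
    C 1 1 1 1 = C 0 0 0 0 ∧ C 1 1 0 0 = C 0 0 1 1 ∧ C 1 0 0 1 = C 0 1 1 0 := by
  have E := fun i j k l => congrFun (congrFun (congrFun (congrFun h i) j) k) l
  refine ⟨?_, ?_, ?_⟩
  · have e := E 0 0 0 0
    simp only [conj2Op_apply, Fin.sum_univ_two] at e
    simpa [swapU] using e
  · have e := E 0 0 1 1
    simp only [conj2Op_apply, Fin.sum_univ_two] at e
    simpa [swapU] using e
  · have e := E 0 1 1 0
    simp only [conj2Op_apply, Fin.sum_univ_two] at e
    simpa [swapU] using e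

/-- Invariance under `conj ⊗ conj` by the rational rotation supplies the last relation. [folklore] -/
theorem rotU_relation (C : Fin 2 → Fin 2 → Fin 2 → Fin 2 → ℂ) (h : conj2Op rotU C = C)
    (z1 : C 0 0 0 1 = 0) (z2 : C 0 0 1 0 = 0) (z3 : C 0 1 0 0 = 0) (z4 : C 1 0 0 0 = 0)
    (z5 : C 1 1 1 0 = 0) (z6 : C 1 1 0 1 = 0) (z7 : C 1 0 1 1 = 0) (z8 : C 0 1 1 1 = 0)
    (z9 : C 0 1 0 1 = 0) (z10 : C 1 0 1 0 = 0) (s1 : C 1 1 1 1 = C 0 0 0 0)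
    (s2 : C 1 1 0 0 = C 0 0 1 1) (s3 : C 1 0 0 1 = C 0 1 1 0) :
    C 0 0 0 0 = C 0 0 1 1 + C 0 1 1 0 := by
  have e := congrFun (congrFun (congrFun (congrFun h 0) 0) 0) 0
  simp only [conj2Op_apply, Fin.sum_univ_two] at e
  simp [rotU, z1, z2, z3, z4, z5, z6, z7, z8, z9, z10, s1, s2, s3] at e
  linear_combination (-(625 : ℂ) / 288) * e

/-- (k4) Schur's lemma for `conj ⊗ conj`, tensor form: a `conj ⊗ conj`-invariant 4-index tensor is isotropic,
`C i j k l = α·[i = j ∧ k = l] + β·[i = l ∧ k = j]`. [folklore] -/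
theorem isotropic_of_conj2_invariant (C : Fin 2 → Fin 2 → Fin 2 → Fin 2 → ℂ)
    (h : ∀ U ∈ Matrix.specialUnitaryGroup (Fin 2) ℂ, conj2Op U C = C) :
    ∃ α β : ℂ, ∀ i j k l : Fin 2, C i j k l =
      α * (if i = j ∧ k = l then 1 else 0) + β * (if i = l ∧ k = j then 1 else 0) := by
  obtain ⟨z1, z2, z3, z4, z5, z6, z7, z8, z9, z10⟩ := ratU_zeros C (h _ ratU_mem)
  obtain ⟨s1, s2, s3⟩ := swapU_pairs C (h _ swapU_mem)
  have r := rotU_relation C (h _ rotU_mem) z1 z2 z3 z4 z5 z6 z7 z8 z9 z10 s1 s2 s3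
  refine ⟨C 0 0 1 1, C 0 1 1 0, fun i j k l => ?_⟩
  fin_cases i <;> fin_cases j <;> fin_cases k <;> fin_cases l <;>
    simp [z1, z2, z3, z4, z5, z6, z7, z8, z9, z10, s1, s2, s3, r]

/-- (k4) with the trace constraint `Σ_i C i i k l = 0` (from `tr X = 0`): one scalar survives, `β = −2α` — the
coordinate form of «∝ Killing form». [folklore] -/
theorem isotropic_traceless_of_conj2_invariant (C : Fin 2 → Fin 2 → Fin 2 → Fin 2 → ℂ)
    (h : ∀ U ∈ Matrix.specialUnitaryGroup (Fin 2) ℂ, conj2Op U C = C)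
    (htr : ∀ k l : Fin 2, C 0 0 k l + C 1 1 k l = 0) :
    ∃ α : ℂ, ∀ i j k l : Fin 2, C i j k l =
      α * ((if i = j ∧ k = l then 1 else 0) - 2 * (if i = l ∧ k = j then 1 else 0)) := by
  obtain ⟨α, β, hC⟩ := isotropic_of_conj2_invariant C h
  have t := htr 0 0
  rw [hC, hC] at t
  simp at t
  have hb : β = -2 * α := by linear_combination t
  refine ⟨α, fun i j k l => ?_⟩
  rw [hC, hb]
  ring

variable [MeasurableSpace X] {μ : Measure X}

/-- The partial trace `v ↦ v 0 0 k l + v 1 1 k l` as a continuous ℝ-linear functional. [folklore] -/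
def slotTraceOp (k l : Fin 2) : (Fin 2 → Fin 2 → Fin 2 → Fin 2 → ℂ) →L[ℝ] ℂ :=
  LinearMap.toContinuousLinearMap
    { toFun := fun v => v 0 0 k l + v 1 1 k l
      map_add' := fun v w => by simp only [Pi.add_apply]; ring
      map_smul' := fun c v => by simp only [Pi.smul_apply, RingHom.id_apply, smul_add] }

/-- `slotTraceOp k l v = v 0 0 k l + v 1 1 k l`. [folklore] -/
@[simp] theorem slotTraceOp_apply (k l : Fin 2) (v : Fin 2 → Fin 2 → Fin 2 → Fin 2 → ℂ) :
    slotTraceOp k l v = v 0 0 k l + v 1 1 k l := rfl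

/-- A pointwise traceless `f` has a second-moment tensor with vanishing partial trace (no integrability
needed). [folklore] -/
theorem slotTrace_secondMoment_eq_zero {f : X → Fin 2 → Fin 2 → ℂ} (htr : ∀ x, f x 0 0 + f x 1 1 = 0)
    (k l : Fin 2) :
    (∫ x, (fun i j k l => f x i j * f x k l) ∂μ) 0 0 k l +
      (∫ x, (fun i j k l => f x i j * f x k l) ∂μ) 1 1 k l = 0 := by
  by_cases hf : Integrable (fun x => fun i j k l => f x i j * f x k l) μ
  · have := (ContinuousLinearMap.integral_comp_comm (slotTraceOp k l) hf)
    have h0 : ∀ x, slotTraceOp k l (fun i j k l => f x i j * f x k l) = 0 := fun x => by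
      simp only [slotTraceOp_apply]
      rw [← add_mul, htr x, zero_mul]
    simp only [h0, integral_zero, slotTraceOp_apply] at this
    exact this.symm
  · simp [integral_undef hf]

/-- (k5) Under `FlatExteriorConjInvariant μ T` and `ConjEquivariant T f`, the second-moment tensor of `f` is
`conj ⊗ conj`-invariant — §2's `integral_fixed_of_invariant` on the 16-dimensional tensor-valued integrand; no
integrability hypothesis. [folklore] -/
theorem secondMoment_invariant {T : Matrix.specialUnitaryGroup (Fin 2) ℂ → X → X}
    (hμ : FlatExteriorConjInvariant μ T) {f : X → Fin 2 → Fin 2 → ℂ} (hf : ConjEquivariant T f)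
    (U : Matrix (Fin 2) (Fin 2) ℂ) (hU : U ∈ Matrix.specialUnitaryGroup (Fin 2) ℂ) :
    conj2Op U (∫ x, (fun i j k l => f x i j * f x k l) ∂μ) =
      ∫ x, (fun i j k l => f x i j * f x k l) ∂μ :=
  integral_fixed_of_invariant (f := fun x => fun i j k l => f x i j * f x k l)
    (hμ ⟨U, hU⟩).1 (hμ ⟨U, hU⟩).2 (conj2Op U) (fun x => prod_conjEquivariant hf ⟨U, hU⟩ x)

/-- (k5) … hence isotropic. [folklore] -/
theorem secondMoment_isotropic {T : Matrix.specialUnitaryGroup (Fin 2) ℂ → X → X}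
    (hμ : FlatExteriorConjInvariant μ T) {f : X → Fin 2 → Fin 2 → ℂ} (hf : ConjEquivariant T f) :
    ∃ α β : ℂ, ∀ i j k l : Fin 2, (∫ x, (fun i j k l => f x i j * f x k l) ∂μ) i j k l =
      α * (if i = j ∧ k = l then 1 else 0) + β * (if i = l ∧ k = j then 1 else 0) :=
  isotropic_of_conj2_invariant _ fun U hU => secondMoment_invariant hμ hf U hU

/-- (k5) … and, for a pointwise traceless integrand, of the one-scalar («Killing form») shape
`α·([i = j ∧ k = l] − 2·[i = l ∧ k = j])`. [folklore] -/
theorem secondMoment_traceless {T : Matrix.specialUnitaryGroup (Fin 2) ℂ → X → X}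
    (hμ : FlatExteriorConjInvariant μ T) {f : X → Fin 2 → Fin 2 → ℂ} (hf : ConjEquivariant T f)
    (htr : ∀ x, f x 0 0 + f x 1 1 = 0) :
    ∃ α : ℂ, ∀ i j k l : Fin 2, (∫ x, (fun i j k l => f x i j * f x k l) ∂μ) i j k l =
      α * ((if i = j ∧ k = l then 1 else 0) - 2 * (if i = l ∧ k = j then 1 else 0)) :=
  isotropic_traceless_of_conj2_invariant _ (fun U hU => secondMoment_invariant hμ hf U hU)
    (slotTrace_secondMoment_eq_zero htr)

end SecondMoment

end Literature.MathematicalPhysics.QuantumFieldTheory.Balaban1983to89.T4AdInvariant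

end
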